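import Literature.MathematicalPhysics.QuantumManyBody.DiluteBoseGasUpperBoundLocalization
import Literature.MathematicalPhysics.QuantumManyBody.PeriodizedPotentialNearestImage
import Mathlib.MeasureTheory.Integral.Marginal
import HarnessLib

/-!
# Outer pair-shell mass bound, part 1: lattice bookkeeping and the fibrewise transfer
# (line `third-law-current-floor`, crux `HardCoreExtension`, stmt-AtomisticToContinuum-11786; support
# for `stub_pairShellMassBoundV2`, node P4 of the (α') plan)

Measure-theoretic half of the outer pair-shell mass bound
(`BECConjugateDominationHardCoreExtensionPairShellMass.lean`):
* `PairShellMass.tsum_indicator_sub_latticeVec_le` — two lattice translates of a ball of radius `R`,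
  `2R < L`, are disjoint, so `∑ₙ 1_S(z - Ln) ≤ 1_{∃ n, z - Ln ∈ S}` for `S ⊂ B(0, R)`;
* `PairShellMass.setLIntegral_cell_latSum_mul` — UNFOLDING ONE PARTICLE against a translated weight:
  `∫_{[0,L)³} (∑ₙ 1_S(y - x₀ - Ln)) G(y) dy = ∫_S G(x₀ + y) dy` for `Lℤ³`-periodic `G ≥ 0`
  (the tiling lemma `lintegral_mul_eq_lintegral_mul_indicator_latSum` and translation invariance);
* `PairShellMass.pair_transfer` — for an ordered pair `i ≠ j`, a fibrewise bound in the pair variable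
  `y = xᵢ - xⱼ` integrates to a bound on the cell `[0,L)^{3N}` with the lattice weights
  `∑ₙ 1_S(xᵢ - xⱼ - Ln)` (the other particles are integrated out by
  `MeasureTheory.lintegral_le_of_lmarginal_le`).
All [folklore]; no named fact is used.
-/

noncomputable section

namespace Summit.AtomisticToContinuum.BoseEinsteinCondensation.Cruxes.HardCoreExtension.ThirdLawCurrentFloor

open MeasureTheory Filter
open scoped ENNReal NNReal BigOperators Topology
open Literature.MathematicalPhysics.QuantumManyBody.BoseGas

namespace PairShellMass

variable {N : ℕ} {L : ℝ}

/-! ### Lattice geometry and indicator bookkeeping -/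

/-- **At most one lattice image.** If `S ⊂ ℝ³` lies in the closed ball of radius `R` with `2R < L`,
then for every `z` at most one translate `z - Ln` lies in `S` (`le_norm_latticeVec_sub_latticeVec`), so the
lattice sum of indicators `∑ₙ 1_S(z - Ln)` is bounded by the indicator of `{∃ n, z - Ln ∈ S}`. [folklore] -/
theorem tsum_indicator_sub_latticeVec_le {S : Set Space} {R : ℝ} (hS : ∀ y ∈ S, ‖y‖ ≤ R)
    (hR : 2 * R < L) (z : Space) :
    ∑' n : Fin 3 → ℤ, S.indicator (1 : Space → ℝ≥0∞) (z - latticeVec L n) ≤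
      {z : Space | ∃ n : Fin 3 → ℤ, z - latticeVec L n ∈ S}.indicator 1 z := by
  by_cases h : ∃ n : Fin 3 → ℤ, z - latticeVec L n ∈ S
  · obtain ⟨n₀, hn₀⟩ := h
    have hL : 0 ≤ L := by
      have h0 := hS _ hn₀
      nlinarith [norm_nonneg (z - latticeVec L n₀)]
    rw [Set.indicator_of_mem (show z ∈ {z : Space | ∃ n : Fin 3 → ℤ, z - latticeVec L n ∈ S} from ⟨n₀, hn₀⟩),
      Pi.one_apply, tsum_eq_single n₀ fun n hn => ?_]
    · rw [Set.indicator_of_mem hn₀, Pi.one_apply]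
    · refine Set.indicator_of_notMem (fun hn' => ?_) _
      have h1 : L ≤ ‖latticeVec L n - latticeVec L n₀‖ := le_norm_latticeVec_sub_latticeVec hL hn
      have h2 : ‖latticeVec L n - latticeVec L n₀‖ ≤ ‖z - latticeVec L n₀‖ + ‖z - latticeVec L n‖ := by
        rw [show latticeVec L n - latticeVec L n₀ = (z - latticeVec L n₀) - (z - latticeVec L n) by abel]
        exact norm_sub_le _ _
      have h3 := hS _ hn₀
      have h4 := hS _ hn'
      linarith
  · push Not at h
    have h0 : ∀ n : Fin 3 → ℤ, S.indicator (1 : Space → ℝ≥0∞) (z - latticeVec L n) = 0 := fun n ↦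
      Set.indicator_of_notMem (h n) _
    simp only [h0, tsum_zero, zero_le]

/-- Comparison of two `{0,1}`-valued indicators through an implication of memberships. [folklore] -/
theorem indicator_one_le_indicator_one {α β : Type*} {s : Set α} {t : Set β} {x : α} {y : β}
    (h : x ∈ s → y ∈ t) : s.indicator (1 : α → ℝ≥0∞) x ≤ t.indicator 1 y := by
  by_cases hx : x ∈ s
  · rw [Set.indicator_of_mem hx, Set.indicator_of_mem (h hx), Pi.one_apply, Pi.one_apply]
  · rw [Set.indicator_of_notMem hx]
    exact zero_le

/-- Updating a coordinate commutes with adding a vector supported on that coordinate. [folklore] -/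
theorem update_add_single (X : Config N) (i : Fin N) (v w : Space) :
    Function.update X i v + Pi.single i w = Function.update X i (v + w) := by
  funext m
  by_cases h : m = i
  · subst h; simp
  · simp [Function.update_of_ne h, Pi.single_eq_of_ne h]

/-! ### Unfolding one particle against a translated weight -/

/-- **Unfolding one particle.** For `G ≥ 0` measurable and `Lℤ³`-periodic, a measurable `S ⊂ ℝ³` and a
base point `x₀`, `∫_{[0,L)³} (∑ₙ 1_S(y - x₀ - Ln)) G(y) dy = ∫_S G(x₀ + y) dy`: the cell is a fundamental
domain (`lintegral_mul_eq_lintegral_mul_indicator_latSum`) and Lebesgue measure is translation invariant.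
[folklore] -/
theorem setLIntegral_cell_latSum_mul (hL : 0 < L) {G : Space → ℝ≥0∞} (hG : Measurable G)
    (hper : ∀ (y : Space) (n : Fin 3 → ℤ), G (y - latticeVec L n) = G y)
    {S : Set Space} (hS : MeasurableSet S) (x₀ : Space) :
    ∫⁻ y in cell L, (∑' n : Fin 3 → ℤ, S.indicator (1 : Space → ℝ≥0∞) (y - x₀ - latticeVec L n)) * G y =
      ∫⁻ y in S, G (x₀ + y) := by
  have hw : Measurable fun y : Space => S.indicator (1 : Space → ℝ≥0∞) (y - x₀) :=
    (measurable_one.indicator hS).comp (measurable_id.sub_const x₀)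
  have h := lintegral_mul_eq_lintegral_mul_indicator_latSum hL hG hw hper
  calc ∫⁻ y in cell L, (∑' n : Fin 3 → ℤ, S.indicator (1 : Space → ℝ≥0∞) (y - x₀ - latticeVec L n)) * G y
      = ∫⁻ y, (cell L).indicator (fun y ↦
          (∑' n : Fin 3 → ℤ, S.indicator (1 : Space → ℝ≥0∞) (y - x₀ - latticeVec L n)) * G y) y :=
        (lintegral_indicator (measurableSet_cell L) _).symm
    _ = ∫⁻ y, G y * (cell L).indicator (fun y ↦
          ∑' n : Fin 3 → ℤ, S.indicator (1 : Space → ℝ≥0∞) (y - latticeVec L n - x₀)) y := by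
        refine lintegral_congr fun y ↦ ?_
        have e : ∀ (z : Space) (n : Fin 3 → ℤ), z - latticeVec L n - x₀ = z - x₀ - latticeVec L n :=
          fun z n ↦ sub_right_comm _ _ _
        by_cases hy : y ∈ cell L
        · simp only [Set.indicator_of_mem hy, e, mul_comm]
        · simp only [Set.indicator_of_notMem hy, mul_zero]
    _ = ∫⁻ y, G y * S.indicator (1 : Space → ℝ≥0∞) (y - x₀) := h.symm
    _ = ∫⁻ y, G (x₀ + y) * S.indicator (1 : Space → ℝ≥0∞) (x₀ + y - x₀) :=
        (lintegral_add_left_eq_self (fun y ↦ G y * S.indicator (1 : Space → ℝ≥0∞) (y - x₀)) x₀).symm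
    _ = ∫⁻ y, S.indicator (fun y ↦ G (x₀ + y)) y := by
        refine lintegral_congr fun y ↦ ?_
        rw [add_sub_cancel_left]
        by_cases hy : y ∈ S
        · simp only [Set.indicator_of_mem hy, Pi.one_apply, mul_one]
        · simp only [Set.indicator_of_notMem hy, mul_zero]
    _ = ∫⁻ y in S, G (x₀ + y) := lintegral_indicator hS _

/-! ### Measurability of the lattice weights and of the pair sets -/

/-- The lattice weight `X ↦ ∑ₙ 1_V(xᵢ - xⱼ - Ln)` of a measurable `V ⊂ ℝ³` is measurable. [folklore] -/
theorem measurable_latSum_indicator (L : ℝ) {V : Set Space} (hV : MeasurableSet V) (i j : Fin N) :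
    Measurable fun X : Config N ↦
      ∑' n : Fin 3 → ℤ, V.indicator (1 : Space → ℝ≥0∞) (X i - X j - latticeVec L n) := by
  refine Measurable.tsum fun n ↦ ?_
  exact (measurable_one.indicator hV).comp
    (((measurable_pi_apply i).sub (measurable_pi_apply j)).sub_const _)

/-- The pair set `{∃ i ≠ j ∃ n, xᵢ - xⱼ - Ln ∈ V}` of a measurable `V ⊂ ℝ³` is measurable. [folklore] -/
theorem measurableSet_pairSet (N : ℕ) (L : ℝ) {V : Set Space} (hV : MeasurableSet V) :
    MeasurableSet {X : Config N | ∃ i j : Fin N, i ≠ j ∧ ∃ n : Fin 3 → ℤ,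
      X i - X j - latticeVec L n ∈ V} := by
  refine measurableSet_setOf.2 (Measurable.exists fun i ↦ Measurable.exists fun j ↦
    measurable_const.and (Measurable.exists fun n ↦ ?_))
  exact (measurable_mem.2 hV).comp (((measurable_pi_apply i).sub (measurable_pi_apply j)).sub_const _)

/-! ### From the pair variable to the `N`-particle cell -/

/-- **Fibrewise transfer.** For an ordered pair `i ≠ j`, functions `A, B, K ≥ 0` on `(ℝ³)^N` invariant
under the lattice translations of particle `i`, measurable `S, T, U ⊂ ℝ³` and constants `c₁, c₂`, a bound
`∫_S A(xᵢ := xⱼ + y) dy ≤ c₁ ∫_T B(xᵢ := xⱼ + y) dy + c₂ ∫_U K(xᵢ := xⱼ + y) dy` for every configuration of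
the other particles integrates to
`∫_cell (∑ₙ 1_S(xᵢ-xⱼ-Ln)) A ≤ c₁ ∫_cell (∑ₙ 1_T(xᵢ-xⱼ-Ln)) B + c₂ ∫_cell (∑ₙ 1_U(xᵢ-xⱼ-Ln)) K`
(unfold particle `i`, `setLIntegral_cell_latSum_mul`; integrate out the others,
`MeasureTheory.lintegral_le_of_lmarginal_le`). [folklore] -/
theorem pair_transfer (hL : 0 < L) {i j : Fin N} (hij : i ≠ j)
    {A B K : Config N → ℝ≥0∞} (hA : Measurable A) (hB : Measurable B) (hK : Measurable K)
    (hAp : ∀ (X : Config N) (n : Fin 3 → ℤ), A (X - Pi.single i (latticeVec L n)) = A X)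
    (hBp : ∀ (X : Config N) (n : Fin 3 → ℤ), B (X - Pi.single i (latticeVec L n)) = B X)
    (hKp : ∀ (X : Config N) (n : Fin 3 → ℤ), K (X - Pi.single i (latticeVec L n)) = K X)
    {S T U : Set Space} (hS : MeasurableSet S) (hT : MeasurableSet T) (hU : MeasurableSet U)
    (c₁ c₂ : ℝ≥0∞)
    (hfib : ∀ X : Config N, ∫⁻ y in S, A (Function.update X i (X j + y)) ≤
      c₁ * (∫⁻ y in T, B (Function.update X i (X j + y))) +
        c₂ * (∫⁻ y in U, K (Function.update X i (X j + y)))) :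
    ∫⁻ X in cellN N L, (∑' n : Fin 3 → ℤ, S.indicator (1 : Space → ℝ≥0∞) (X i - X j - latticeVec L n)) * A X ≤
      c₁ * (∫⁻ X in cellN N L,
          (∑' n : Fin 3 → ℤ, T.indicator (1 : Space → ℝ≥0∞) (X i - X j - latticeVec L n)) * B X) +
        c₂ * (∫⁻ X in cellN N L,
          (∑' n : Fin 3 → ℤ, U.indicator (1 : Space → ℝ≥0∞) (X i - X j - latticeVec L n)) * K X) := by
  have hmA : Measurable fun X : Config N ↦
      (∑' n : Fin 3 → ℤ, S.indicator (1 : Space → ℝ≥0∞) (X i - X j - latticeVec L n)) * A X :=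
    (measurable_latSum_indicator L hS i j).mul hA
  have hmB : Measurable fun X : Config N ↦
      (∑' n : Fin 3 → ℤ, T.indicator (1 : Space → ℝ≥0∞) (X i - X j - latticeVec L n)) * B X :=
    (measurable_latSum_indicator L hT i j).mul hB
  have hmK : Measurable fun X : Config N ↦
      (∑' n : Fin 3 → ℤ, U.indicator (1 : Space → ℝ≥0∞) (X i - X j - latticeVec L n)) * K X :=
    (measurable_latSum_indicator L hU i j).mul hK
  rw [← lintegral_const_mul c₁ hmB, ← lintegral_const_mul c₂ hmK,
    ← lintegral_add_left (hmB.const_mul c₁), volume_restrict_cellN]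
  refine lintegral_le_of_lmarginal_le {i} hmA ((hmB.const_mul c₁).add (hmK.const_mul c₂)) ?_
  intro X
  have hji : j ≠ i := fun h ↦ hij h.symm
  simp only [lmarginal_singleton, Function.update_self, Function.update_of_ne hji]
  -- the fibre functions
  have hGA : Measurable fun y : Space ↦ A (Function.update X i y) := hA.comp (measurable_update X)
  have hGB : Measurable fun y : Space ↦ B (Function.update X i y) := hB.comp (measurable_update X)
  have hGK : Measurable fun y : Space ↦ K (Function.update X i y) := hK.comp (measurable_update X)
  have hpA : ∀ (y : Space) (n : Fin 3 → ℤ),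
      A (Function.update X i (y - latticeVec L n)) = A (Function.update X i y) := fun y n ↦ by
    rw [update_sub_single, hAp]
  have hpB : ∀ (y : Space) (n : Fin 3 → ℤ),
      B (Function.update X i (y - latticeVec L n)) = B (Function.update X i y) := fun y n ↦ by
    rw [update_sub_single, hBp]
  have hpK : ∀ (y : Space) (n : Fin 3 → ℤ),
      K (Function.update X i (y - latticeVec L n)) = K (Function.update X i y) := fun y n ↦ by
    rw [update_sub_single, hKp]
  have hwy : ∀ {V : Set Space}, MeasurableSet V → Measurable fun y : Space ↦
      ∑' n : Fin 3 → ℤ, V.indicator (1 : Space → ℝ≥0∞) (y - X j - latticeVec L n) := by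
    intro V hV
    exact Measurable.tsum fun n ↦
      (measurable_one.indicator hV).comp ((measurable_id.sub_const _).sub_const _)
  have hmTB : Measurable fun y : Space ↦
      (∑' n : Fin 3 → ℤ, T.indicator (1 : Space → ℝ≥0∞) (y - X j - latticeVec L n)) *
        B (Function.update X i y) := (hwy hT).mul hGB
  have hmUK : Measurable fun y : Space ↦
      (∑' n : Fin 3 → ℤ, U.indicator (1 : Space → ℝ≥0∞) (y - X j - latticeVec L n)) *
        K (Function.update X i y) := (hwy hU).mul hGK
  rw [setLIntegral_cell_latSum_mul hL hGA hpA hS (X j), lintegral_add_left (hmTB.const_mul c₁),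
    lintegral_const_mul c₁ hmTB, lintegral_const_mul c₂ hmUK, setLIntegral_cell_latSum_mul hL hGB hpB hT (X j),
    setLIntegral_cell_latSum_mul hL hGK hpK hU (X j)]
  exact hfib X

end PairShellMass

open PairShellMass in
/-- **`stub_pairShellMassTransfer`** (registered sub-goal of `stub_pairShellMassBoundV2`, line
`third-law-current-floor`): the fibrewise transfer `PairShellMass.pair_transfer` in closed form — for an
ordered pair `i ≠ j`, measurable `S, T, U ⊂ ℝ³`, functions `A, B, K ≥ 0` on `(ℝ³)^N` invariant under the
lattice translations of particle `i` and constants `c₁, c₂`, a bound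
`∫_S A(xᵢ := xⱼ + y) dy ≤ c₁ ∫_T B(xᵢ := xⱼ + y) dy + c₂ ∫_U K(xᵢ := xⱼ + y) dy` for every configuration
integrates to `∫_cell (∑ₙ 1_S(xᵢ-xⱼ-Ln)) A ≤ c₁ ∫_cell (∑ₙ 1_T(xᵢ-xⱼ-Ln)) B + c₂ ∫_cell (∑ₙ 1_U(xᵢ-xⱼ-Ln)) K`.
[folklore] -/
theorem stub_pairShellMassTransfer :
    ∀ (N : ℕ) (L : ℝ), 0 < L → ∀ (i j : Fin N), i ≠ j →
      ∀ (S T U : Set Space), MeasurableSet S → MeasurableSet T → MeasurableSet U →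
      ∀ (A B K : Config N → ℝ≥0∞), Measurable A → Measurable B → Measurable K →
      (∀ (X : Config N) (n : Fin 3 → ℤ), A (X - Pi.single i (latticeVec L n)) = A X) →
      (∀ (X : Config N) (n : Fin 3 → ℤ), B (X - Pi.single i (latticeVec L n)) = B X) →
      (∀ (X : Config N) (n : Fin 3 → ℤ), K (X - Pi.single i (latticeVec L n)) = K X) →
      ∀ (c₁ c₂ : ℝ≥0∞),
      (∀ X : Config N, ∫⁻ y in S, A (Function.update X i (X j + y)) ≤
        c₁ * (∫⁻ y in T, B (Function.update X i (X j + y))) +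
          c₂ * ∫⁻ y in U, K (Function.update X i (X j + y))) →
      ∫⁻ X in cellN N L, (∑' n : Fin 3 → ℤ, S.indicator (1 : Space → ℝ≥0∞) (X i - X j - latticeVec L n)) * A X ≤
        c₁ * (∫⁻ X in cellN N L,
            (∑' n : Fin 3 → ℤ, T.indicator (1 : Space → ℝ≥0∞) (X i - X j - latticeVec L n)) * B X) +
          c₂ * ∫⁻ X in cellN N L,
            (∑' n : Fin 3 → ℤ, U.indicator (1 : Space → ℝ≥0∞) (X i - X j - latticeVec L n)) * K X :=
  fun _ _ hL _ _ hij _ _ _ hS hT hU _ _ _ hA hB hK hAp hBp hKp c₁ c₂ hfib ↦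
    pair_transfer hL hij hA hB hK hAp hBp hKp hS hT hU c₁ c₂ hfib

end Summit.AtomisticToContinuum.BoseEinsteinCondensation.Cruxes.HardCoreExtension.ThirdLawCurrentFloor

end
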